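import Literature.Probability.LatticeModels.ImprovedTreeDiagramBoundAssembly
import HarnessLib

/-!
# Transfer of two-point-function estimates to large boxes: `(1-η)⟨σ_aσ_b⟩_β ≤ ⟨σ_aσ_b⟩^∅_{Λ_L} ≤ ⟨σ_aσ_b⟩_β` eventually

Topic `Literature/Probability/LatticeModels`. Theorems only: no definition and no named fact is introduced.

The estimates on the infinite-volume two-point function `S_β(x) = ⟨σ₀σ_x⟩_β` of the nearest-neighbour
Ising model that drive the proof of the mixing property and of the intersection property of random
currents (M. Aizenman, H. Duminil-Copin, Ann. of Math. **194** (2021), arXiv:1912.07973, §5–§6: regular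
scales, infrared and lower bounds) are used inside finite-volume random-current computations ("We work
with finite `Λ` and then take the limit as `Λ ↗ ℤ^d`", Appendix A.2, p. 32). The passage rests on the
following elementary fact, recorded here once: for `β ≥ 0` and finitely many pairs of sites, the free
finite-volume two-point functions of the boxes `Λ_L` are squeezed, for all large `L`, between
`(1-η) S_β(b-a)` and `S_β(b-a)`:

* `isingTwoPoint_box_le_twoPointFree` — the upper bound `⟨σ_aσ_b⟩^∅_{Λ} ≤ S_β(b-a)` for `a, b ∈ Λ`
  (Griffiths' second inequality: monotonicity in the volume, and translation invariance of the free
  state — theorems of the tree);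
* `tendsto_isingTwoPoint_box_sub` — `⟨σ_aσ_b⟩^∅_{Λ_L} → S_β(b-a)` (box convergence of the free pair
  correlations, `tendsto_isingTwoPoint_free_pair`, and translation invariance of the free state);
* `eventually_box_twoPoint_ge` / `eventually_box_twoPoint_approx` — for a finite set `P` of pairs and
  `η > 0`, eventually in `L`: `(1-η) S_β(b-a) ≤ ⟨σ_aσ_b⟩^∅_{Λ_L} ≤ S_β(b-a)` for all `(a,b) ∈ P`.

## References

* M. Aizenman, H. Duminil-Copin, Ann. of Math. 194 (2021), arXiv:1912.07973, Appendix A.2 ("We work with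
  finite `Λ` and then take the limit") [AizenmanDuminilCopinAnnals2021].
* S. Friedli, Y. Velenik, *Statistical Mechanics of Lattice Systems* (2017), Exercise 3.16 (free state),
  Exercise 3.12 (volume monotonicity), proof of Thm 3.17 (translation invariance) [FriedliVelenik2017].

## Mathlib

`Filter.Tendsto.eventually`, `Finset.eventually_all`, `eventually_mem_box` (tree), `lt_mem_nhds`.
-/

noncomputable section

open Finset Filter Topology

namespace Literature.Probability.LatticeModels

variable {d : ℕ}

/-- **The upper bound**: `⟨σ_aσ_b⟩^∅_{Λ;β} ≤ S_β(b-a)` for `β ≥ 0` and `a, b ∈ Λ` (Griffiths II: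
`⟨·⟩^∅_Λ` is non-decreasing in `Λ`, and the free state is translation invariant). [cite: FriedliVelenik2017, Exercise 3.12 and proof of Thm 3.17 (p. 114)] -/
theorem isingTwoPoint_box_le_twoPointFree {β : ℝ} (hβ : 0 ≤ β) {Λ : Finset (Site d)} {a b : Site d}
    (ha : a ∈ Λ) (hb : b ∈ Λ) : isingTwoPoint (zdGraph d) Λ β 0 .free a b ≤ twoPointFree d β (b - a) :=
  isingTwoPoint_free_le_twoPointFree_sub isingCorr_free_mono_volume_holds hasBoxLimit_isingCorr_free_holds
    isingTwoPoint_free_translate_holds hβ ha hb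

/-- Box convergence to the translation-invariant limit: `⟨σ_aσ_b⟩^∅_{Λ_L;β} → S_β(b-a)` (`β ≥ 0`). The
value of the limit, `⟨σ_aσ_b⟩^∅_β = S_β(b-a)` (translation invariance of the free state; in the tree as
`freePair_eq_twoPointFree_sub`, in a file outside this import chain), is re-derived inline from the
tree's `twoPointFree_sub_le_freePair` and the upper bound along boxes. [cite: FriedliVelenik2017, Exercise 3.16 and proof of Thm 3.17 (p. 114)] -/
theorem tendsto_isingTwoPoint_box_sub {β : ℝ} (hβ : 0 ≤ β) (a b : Site d) :
    Tendsto (fun L : ℕ => isingTwoPoint (zdGraph d) (box d L) β 0 .free a b) atTop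
      (𝓝 (twoPointFree d β (b - a))) := by
  have hlim := tendsto_isingTwoPoint_free_pair hasBoxLimit_isingCorr_free_holds hβ a b
  have heq : freePair d β a b = twoPointFree d β (b - a) := by
    refine le_antisymm (le_of_tendsto hlim ?_) (twoPointFree_sub_le_freePair hβ a b)
    filter_upwards [eventually_mem_box a, eventually_mem_box b] with L ha hb
    exact isingTwoPoint_box_le_twoPointFree hβ ha hb
  rw [← heq]
  exact hlim

/-- **The lower bound, eventually**: for `β ≥ 0`, `η > 0` and one pair `(a,b)`, eventually in `L`,
`(1-η) S_β(b-a) ≤ ⟨σ_aσ_b⟩^∅_{Λ_L;β}`. [cite: AizenmanDuminilCopinAnnals2021, arXiv:1912.07973 Appendix A.2 ("We work with finite Λ and then take the limit")] -/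
theorem eventually_box_twoPoint_ge {β : ℝ} (hβ : 0 ≤ β) {η : ℝ} (hη : 0 < η) (a b : Site d) :
    ∀ᶠ L : ℕ in atTop, (1 - η) * twoPointFree d β (b - a) ≤ isingTwoPoint (zdGraph d) (box d L) β 0 .free a b := by
  have hS0 : 0 ≤ twoPointFree d β (b - a) :=
    twoPointFree_nonneg hasBoxLimit_isingCorr_free_holds (fun {_ _ _ _ _} => GKSInequalities.gks_one_holds (zdGraph d)) hβ _
  rcases hS0.lt_or_eq with hpos | hzero
  · have hlt : (1 - η) * twoPointFree d β (b - a) < twoPointFree d β (b - a) := by nlinarith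
    exact ((tendsto_isingTwoPoint_box_sub hβ a b).eventually (lt_mem_nhds hlt)).mono fun L hL => hL.le
  · filter_upwards [eventually_mem_box a, eventually_mem_box b] with L ha hb
    rw [← hzero, mul_zero]
    exact isingTwoPoint_free_nonneg (fun {_ _ _ _ _} => GKSInequalities.gks_one_holds (zdGraph d)) hβ ha hb

/-- **Transfer of two-point estimates to large boxes** (finitely many pairs): for `β ≥ 0`, a finite set
`P` of pairs of sites and `η > 0`, eventually in `L`, for every `(a,b) ∈ P`:
`(1-η) S_β(b-a) ≤ ⟨σ_aσ_b⟩^∅_{Λ_L;β} ≤ S_β(b-a)` (and `a, b ∈ Λ_L`). [cite: AizenmanDuminilCopinAnnals2021, arXiv:1912.07973 Appendix A.2 ("We work with finite Λ and then take the limit")] -/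
theorem eventually_box_twoPoint_approx {β : ℝ} (hβ : 0 ≤ β) (P : Finset (Site d × Site d)) {η : ℝ}
    (hη : 0 < η) :
    ∀ᶠ L : ℕ in atTop, ∀ ab ∈ P, ab.1 ∈ box d L ∧ ab.2 ∈ box d L ∧
      (1 - η) * twoPointFree d β (ab.2 - ab.1) ≤ isingTwoPoint (zdGraph d) (box d L) β 0 .free ab.1 ab.2 ∧
      isingTwoPoint (zdGraph d) (box d L) β 0 .free ab.1 ab.2 ≤ twoPointFree d β (ab.2 - ab.1) := by
  refine P.eventually_all.2 fun ab _ => ?_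
  filter_upwards [eventually_mem_box ab.1, eventually_mem_box ab.2, eventually_box_twoPoint_ge hβ hη ab.1 ab.2]
    with L ha hb hge
  exact ⟨ha, hb, hge, isingTwoPoint_box_le_twoPointFree hβ ha hb⟩

end Literature.Probability.LatticeModels
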